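import Summits.ValiantsHypothesis.ValiantsHypothesis.Theorems.KPlusLogSqLawTropicalBStaticPorts
import Summits.ValiantsHypothesis.ValiantsHypothesis.Theorems.KPlusLogSqLawTropicalBShadowCap

/-!
# Route `KPlusLogSqLaw`, crux `TropicalB` — static versus general capacity: the law-level equivalence, lossless rows

HONEST FRAMING.  Support file toward the registered stubs `stub_tropThin` / `stub_tropFat` of the crux `TropicalB`
(ledger item `stmt-ValiantsHypothesis-19771`, route `KPlusLogSqLaw`; cell `pub-symmetroid`, seat val-sym-trop-p4, 2026-08-26).
Corollaries of the static port embedding `tropRootLawAt_of_static_ports` (`…TropicalBStaticPorts`): nothing new is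
constructed, no stub is proved, nothing is asserted about `TropicalB` inside its window, `Lifting`, `KPlusLogSqLaw`,
`MatrixDescartes` or `VP ≠ VNP`.

* `not_tropRootLawAtStatic_mul_of_not` — lower bounds transfer to STATIC designs at `K`-fold size: a general `(m, K)`
  design beating the row bound `B` yields a static `(m·K, K)` design beating `B` (contrapositive of the embedding).  So
  every explicit family of the cell (SHIFT-THREE, the staircase read as a design, …) has a static twin with the same count.
* `tropKPlusLogSqLaw_iff_static` — **`TropKPlusLogSqLaw` ⟺ the same `K + log² m` law for STATIC designs** (plain
  K-slope parametric assignment instances), with constants `C ↦ C` one way and `C ↦ C·(3A+7)` the other (`A` the absolute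
  constant of `KPlusLogSqLaw.exists_logsq_le_add`, from `log₂²(m·K) ≤ 3·log₂² m + 3K + 3A + 3`).  The tree's static
  reduction `tropRootLawAt_of_static` gives the same equivalence with a different constant; the port route keeps the row
  bound and moves the size instead.

[folklore] (bookkeeping on the two reductions).
-/

-- `Summit.ValiantsHypothesis.ValiantsHypothesis.…` repeats a component by the D-0017 layout
-- (single-conjunct summit), which the `dupNamespace` linter flags; the name is mandated.
set_option linter.dupNamespace false
set_option autoImplicit false

namespace Summit.ValiantsHypothesis.ValiantsHypothesis.Theorems.LacunarySymmetroidMatrixDescartes.TropicalCensus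

open Summit.ValiantsHypothesis.ValiantsHypothesis.Theorems.MatrixDescartes.Negative

/-- **Lower bounds go static at `K`-fold size.**  If some `(m, K)` design has a dominant sign-alternating chain longer than
`B` (`¬ TropRootLawAt m K B`), then some STATIC `(m·K, K)` design has one too. [folklore] -/
theorem not_tropRootLawAtStatic_mul_of_not {m K B : ℕ} (h : ¬ TropRootLawAt m K B) :
    ¬ TropRootLawAtStatic (m * K) K B :=
  fun hs => h (tropRootLawAt_of_static_ports m K B hs)

/-- exponent bookkeeping for the size change `m ↦ m·K`: for `K ≥ 1`,
`C·(K + ⌊log₂(m·K)⌋²) ≤ C·(3A+7)·(K + ⌊log₂ m⌋²)` whenever `⌊log₂ x⌋² ≤ x + A` for all `x`. [folklore] -/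
theorem mul_logsq_mul_le (A : ℕ) (hA : ∀ x : ℕ, Nat.log 2 x ^ 2 ≤ x + A) (C m K : ℕ) (hK : 1 ≤ K) :
    C * (K + Nat.log 2 (m * K) ^ 2) ≤ C * (3 * A + 7) * (K + Nat.log 2 m ^ 2) := by
  have h1 : Nat.log 2 (m * K) ≤ Nat.log 2 m + Nat.log 2 K + 1 := by
    have := Summit.ValiantsHypothesis.ValiantsHypothesis.Theorems.KPlusLogSqLaw.log_two_mul_lt m K
    omega
  have h2 : Nat.log 2 (m * K) ^ 2 ≤ 3 * (Nat.log 2 m ^ 2 + Nat.log 2 K ^ 2 + 1) :=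
    (Nat.pow_le_pow_left h1 2).trans
      (Summit.ValiantsHypothesis.ValiantsHypothesis.Theorems.KPlusLogSqLaw.sq_add_add_one_le _ _)
  have h3 := hA K
  rw [Nat.mul_assoc]
  apply Nat.mul_le_mul_left
  nlinarith

/-- **`TropKPlusLogSqLaw` ⟺ its STATIC form.**  The tropical `K + log² m` law holds for all dominance designs iff it holds
for static ones (every entry carries at most one class: K-slope parametric ASSIGNMENT instances).  `→`: static designs
are designs (`tropRootLawAtStatic_of_tropRootLawAt`).  `←`: the port embedding at size `m·K`
(`tropRootLawAt_of_static_ports`) and `⌊log₂(m·K)⌋² ≤ 3⌊log₂ m⌋² + 3K + O(1)` (`mul_logsq_mul_le`). [folklore] -/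
theorem tropKPlusLogSqLaw_iff_static :
    TropKPlusLogSqLaw ↔ ∃ C : ℕ, ∀ m K : ℕ, TropRootLawAtStatic m K (2 ^ (C * (K + Nat.log 2 m ^ 2))) := by
  constructor
  · rintro ⟨C, hC⟩
    exact ⟨C, fun m K => tropRootLawAtStatic_of_tropRootLawAt (hC m K)⟩
  · rintro ⟨C, hC⟩
    obtain ⟨A, hA⟩ := Summit.ValiantsHypothesis.ValiantsHypothesis.Theorems.KPlusLogSqLaw.exists_logsq_le_add
    refine ⟨C * (3 * A + 7), fun m K => ?_⟩
    rcases Nat.eq_zero_or_pos K with rfl | hK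
    · exact tropRootLawAt_zero m _
    · exact tropRootLawAt_mono (Nat.pow_le_pow_right (by norm_num) (mul_logsq_mul_le A hA C m K hK))
        (tropRootLawAt_of_static_ports m K _ (hC (m * K) K))

end Summit.ValiantsHypothesis.ValiantsHypothesis.Theorems.LacunarySymmetroidMatrixDescartes.TropicalCensus
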